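/-
Copyright (c) 2026 the pub-hodgecm-mathlib formalisation cell (harness21).  R90-TF SLAB, section S10 (Rogawski 1990, §13.6–13.8 read at `v`),
prover R90-C138-p08 (g0) — DEAL #15 (M1) LINKAGE (R90-C138-plan (g2) 2026-09-05T00:49:30Z); h413 = `stmt-HodgeConjecture-24833`, route `HCCMUnconditional`.
-/
import Summits.HodgeConjecture.HodgeConjecture.Theorems.R90S10FrozenDatumDefs       -- ★ S10 FILE C2: `IsLinked`, `HasLocalClasses` (+ ★ `F0P3GlobalPacketDiscrete`: `exists_forall_isConstituentOf_iff`)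
import HarnessLib

/-!
# R90-TF ∕ S10 — (M1) LINKAGE: a discrete class of `U(H)` with an irreducible admissible finite-component model IS LINKED to a family of local classes
# (`Theorems/R90S10IsLinkedOfFinComponent.lean`; ns `Summit.HodgeConjecture.HodgeConjecture.R90.S10`; LAW L9: ★ `Theorems` imports only; THEOREMS ONLY — no `def`,
# no instance, no notation, no `sorry`)

Print: [Rogawski1990] §13.3 p. 199 ¶2 («an irreducible unitary representation `π = ⊗π_v` … occurs in the discrete spectrum»); [FlathCorvallis1979] Thm. 3 (an irreducible
admissible representation of the finite-adelic group is a restricted tensor product `⊗'π_v`, the local factors `π_v` unique up to isomorphism); [BorelJacquet1979] §4.6.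

## WHAT THIS FILE PROVES
★ C2's membership predicate `S10MemG` and ★ `RigidityAtGermLetter` (P-rig) ask, for a discrete class `c` of `U(Φ₃)`, for local classes `πc` with ★ `IsLinked L 3 (qsForm L) μG c πc`
(`R90S10FrozenDatumDefs` :162: SOME occurrence witness `P` of class `c` with a finite component `σf` (★ `HasFinComponent`) having the local classes `πc w` EXACTLY, ★
`HasLocalClasses` :150: irreducible ∧ smooth ∧ admissible ∧ «constituents of `σf|_{U(H)(L⁺_w)}` = `{comap (localPiEquiv w) (πc w)}`»).  The (M1) input of the (P-rig)
decomposition (dealer RULING W1-H5) is: every class with a finite-component model HAS such local classes.  This is Flath's theorem, ALREADY ★ in the tree in relational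
form — ★ `F0P3GlobalPacketDiscrete.exists_forall_isConstituentOf_iff` (`Theorems/F0P3GlobalPacketDiscrete.lean` :94: for `σ` irreducible admissible there is THE family
`v ↦ π_v` of constituent classes of `σ|_{U(J)(F_v)}`, existence ★ `exists_isConstituentOf_comp_inclPlace` + uniqueness ★ `isConstituentOf_comp_inclPlace_subsingleton`) —
so this file is a READ-BACK in S10 currency (generic `N`, `H`):
* `hasLocalClasses_of_irreducible_admissible` — an irreducible admissible `σf` on `U(H)(𝔸_f)` HAS local classes: `∃ π, HasLocalClasses L N H σf π` (smoothness from
  admissibility, ★ `Representation.IsAdmissible.isSmooth`; the family transported to the `cmDatum` model along ★ `localPiEquiv`, ★ `IrrClass.comap_comap_symm`).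
* `exists_isLinked_of_hasFinComponent` — **(M1)**: `DiscreteClass.mk P = c`, `P.HasFinComponent σf`, `σf` irreducible admissible ⇒ `∃ π, IsLinked L N H μA c π`.
CONSUMERS: p02 (g0)'s card 6a (member packages PRODUCE `HasFinComponent`; this file CONSUMES it), D ED. 4's (M1) binder, the (P-rig) assembly.
HONEST LABEL: read-back of ★ Flath bookkeeping; pays no socket; HC_CM is proved only modulo the 7 printed citations (2 remaining named inputs: hLiu418 =
`stmt-HodgeConjecture-24832`, h413 = `stmt-HodgeConjecture-24833`) until rung 0 closes; REL ≠ ★ ≠ BUILT.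
-/

set_option autoImplicit false
set_option linter.dupNamespace false

noncomputable section

open scoped RestrictedProduct Matrix MatrixGroups
open Filter MeasureTheory NumberField IsDedekindDomain CompactlySupported
open Literature.NumberTheory.Rogawski1990 Literature.NumberTheory.Automorphic Literature.NumberTheory.Automorphic.UnitaryGroup
open Literature.NumberTheory.Automorphic.UnitaryGroup.CotangentForms Literature.NumberTheory.GaloisRepresentations
open Summit.HodgeConjecture.HodgeConjecture.Cruxes.H413.K2E1TraceFormulaBeta
open Summit.HodgeConjecture.HodgeConjecture.Cruxes.H413.K2E1SpectralTermsDiscreteHalf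
open Summit.HodgeConjecture.HodgeConjecture.Cruxes.H413.F0P3GlobalPacketDiscrete (exists_forall_isConstituentOf_iff)

namespace Summit.HodgeConjecture.HodgeConjecture.R90.S10

section Linkage

variable (L : Type) [Field L] [NumberField L] [IsCMField L] (N : ℕ) (H : Matrix (Fin N) (Fin N) L)

/-- **An irreducible admissible `σf` on `U(H)(𝔸_f)` HAS LOCAL CLASSES** (★ `HasLocalClasses L N H σf π` for some `π`): Flath's family of constituent classes of
`σf|_{U(H)(L⁺_w)}` (★ `exists_forall_isConstituentOf_iff`), transported to the `cmDatum` model of `U(H)(L⁺_w)` along ★ `localPiEquiv` (`π w := comap (localPiEquiv w)⁻¹ π_w`,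
read back by ★ `IrrClass.comap_comap_symm`); smoothness of `σf` is part of admissibility. [cite: FlathCorvallis1979, Thm. 3] [cite: BorelJacquet1979, §4.6]
[cite: Rogawski1990, §13.3 p. 199 ¶2] -/
theorem hasLocalClasses_of_irreducible_admissible {W : Type} [AddCommGroup W] [Module ℂ W]
    (σf : Representation ℂ (finAdelic (↥(maximalRealSubfield L)) L (IsCMField.complexConj L) N H) W)
    (hirr : σf.IsIrreducible) (hadm : σf.IsAdmissible) :
    ∃ π : ∀ w : Pl L, IrrClass ((UnitaryGroup.cmDatum L N H).Local w), HasLocalClasses L N H σf π := by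
  obtain ⟨π, hπ⟩ := exists_forall_isConstituentOf_iff hirr hadm
  refine ⟨fun w => IrrClass.comap (localPiEquiv L (IsCMField.complexConj L) N H w).symm (π w), hirr, hadm.isSmooth, hadm, fun w c₀ => ?_⟩
  rw [hπ w c₀]
  constructor
  · rintro rfl
    exact (IrrClass.comap_comap_symm _ _).symm
  · intro h
    rw [h]
    exact IrrClass.comap_comap_symm _ _

/-- **(M1) LINKAGE — a discrete class with an irreducible admissible finite-component model IS LINKED**: if `DiscreteClass.mk P = c` and `P.HasFinComponent σf` with `σf`
irreducible admissible, then `∃ π, IsLinked L N H μA c π` (★ C2 :162) — the witness is `(P, σf)` itself with Flath's local classes.  At `N = 3`, `H = qsForm L` this is the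
(M1) input of ★ `RigidityAtGermLetter`'s decomposition (RULING W1-H5): it CONSUMES `HasFinComponent` (p02's member packages produce it).
[cite: Rogawski1990, §13.3 p. 199 ¶2] [cite: FlathCorvallis1979, Thm. 3] [cite: BorelJacquet1979, §4.6] -/
theorem exists_isLinked_of_hasFinComponent
    (μA : Measure (adelicGroupData (↥(maximalRealSubfield L)) L (IsCMField.complexConj L) N H).automorphicQuotient)
    [(adelicGroupData (↥(maximalRealSubfield L)) L (IsCMField.complexConj L) N H).IsAutomorphicMeasure μA]
    (c : DiscreteClass (adelicGroupData (↥(maximalRealSubfield L)) L (IsCMField.complexConj L) N H) μA)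
    (P : DiscreteAutomorphicRep (adelicGroupData (↥(maximalRealSubfield L)) L (IsCMField.complexConj L) N H) μA) (hPc : DiscreteClass.mk P = c)
    {W : Type} [AddCommGroup W] [Module ℂ W]
    (σf : Representation ℂ (finAdelic (↥(maximalRealSubfield L)) L (IsCMField.complexConj L) N H) W)
    (hirr : σf.IsIrreducible) (hadm : σf.IsAdmissible) (hP : P.HasFinComponent σf) :
    ∃ π : ∀ w : Pl L, IrrClass ((UnitaryGroup.cmDatum L N H).Local w), IsLinked L N H μA c π := by
  obtain ⟨π, hπ⟩ := hasLocalClasses_of_irreducible_admissible L N H σf hirr hadm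
  exact ⟨π, P, W, inferInstance, inferInstance, σf, hPc, hP, hπ⟩

end Linkage

end Summit.HodgeConjecture.HodgeConjecture.R90.S10

end
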